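import Summits.BirchSwinnertonDyer.BirchSwinnertonDyer.Theorems.KolyvaginDepthDoorDepthTableSteinWuthrichRankThree
import Summits.BirchSwinnertonDyer.BirchSwinnertonDyer.Theorems.KolyvaginDepthDoorDepthTableSteinWuthrichRankThree11197a1
import Summits.BirchSwinnertonDyer.BirchSwinnertonDyer.Theorems.KolyvaginDepthDoorDepthTableSteinWuthrichRankThree11197a1TwistLValue
import Summits.BirchSwinnertonDyer.BirchSwinnertonDyer.Theorems.KolyvaginDepthDoorDepthTableSteinWuthrichRankThree16811a1
import Summits.BirchSwinnertonDyer.BirchSwinnertonDyer.Theorems.KolyvaginDepthDoorDepthTableSteinWuthrichRankThree16811a1TwistLValue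
import Summits.BirchSwinnertonDyer.BirchSwinnertonDyer.Theorems.KolyvaginDepthDoorDepthTableSteinWuthrichRankThree18097b1
import Summits.BirchSwinnertonDyer.BirchSwinnertonDyer.Theorems.KolyvaginDepthDoorDepthTableSteinWuthrichRankThree18097b1TwistLValue
import Summits.BirchSwinnertonDyer.BirchSwinnertonDyer.Theorems.KolyvaginDepthDoorDepthTableSteinWuthrichRankThree11642a1
import Summits.BirchSwinnertonDyer.BirchSwinnertonDyer.Theorems.KolyvaginDepthDoorDepthTableSteinWuthrichRankThree11642a1TwistLValue
import Summits.BirchSwinnertonDyer.BirchSwinnertonDyer.Theorems.KolyvaginDepthDoorDepthTableSteinWuthrichRankThree13766a1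
import Summits.BirchSwinnertonDyer.BirchSwinnertonDyer.Theorems.KolyvaginDepthDoorDepthTableSteinWuthrichRankThree13766a1TwistLValue
import Summits.BirchSwinnertonDyer.BirchSwinnertonDyer.Theorems.KolyvaginDepthDoorDepthTableSteinWuthrichRankThree12279a1
import Summits.BirchSwinnertonDyer.BirchSwinnertonDyer.Theorems.KolyvaginDepthDoorDepthTableSteinWuthrichRankThree12279a1TwistLValue
import HarnessLib

/-!
# Route `KolyvaginDepthDoor`, crux `KolyvaginDepthSupplyKN` (stmt-BirchSwinnertonDyer-22820) —
# DEPTH TABLE v14: the odd-rank rows `11197a1`, `16811a1`, `18097b1`, `11642a1`, `13766a1`, `12279a1` CLOSED MODULO ONE `L`-VALUE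
# VALUATION EACH (compositions: Skinner 2016 Thm. C on the rank-zero twist + the row's `cruxBody_of_twistSelmer`)

Helper file of the lead prover of line `levelone` (kdd-p1 g18; `--supports stmt-BirchSwinnertonDyer-22820
--as helper`); it closes nothing and BSD is NOT proved by it.

For each of the six curves (`12279a1` at `d_K = −47`, the others at `d_K = −7`) the row file `…RankThree<label>` gives the CLAUSE of `KolyvaginDepthSupplyKN` at the curve from
ONE bound `#Sel_5(E^{(d_K)}/ℚ) ≤ 5³`, and `…RankThree<label>TwistLValue` gives `#Sel_5(E^{(d_K)}/ℚ) = 1` from Skinner 2016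
Thm. C + Gross–Zagier–Kolyvagin BY NAME and two `L`-value hypotheses on the minimal twist model `T₀` (`L(T,1) ≠ 0`,
numerically true — `L ≈ 5.30, 5.25, 4.10, 7.22, 6.59, 3.18` —, and `ord_5(L(T,1)/Ω_T) ≤ 0`, one modular-symbol computation).
Here the one-line compositions `C<label>.cruxBody_of_twistLValue` (the `5077a1` one is `…RankThree5077a1Exact`):
**modulo FOUR named print facts (Stein–Wuthrich 2013 Thm. 1.1, W. Zhang 2014 L8.4 (1) / Thm. 9.1, Skinner 2016 Thm. C,
Gross–Zagier–Kolyvagin) the crux holds AT EACH OF THESE RANK-THREE CURVES as soon as one exact rational number per curve —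
the algebraic part of the central value of its rank-zero Heegner twist — has `5`-adic valuation `≤ 0`.** Per curve; nothing
class-wide (the open stub (S♭) is untouched); BSD is NOT proved by any of this.

References: [SteinWuthrich2013] Thm. 1.1; [WZhang2014] Lemma 8.4 (1), Thm. 9.1; [Skinner2016PacificMC] Thm. C (p. 173);
[Darmon2004] Thm. 3.22; [CremonaAlgorithms1997] Table 1.
-/

set_option linter.dupNamespace false

noncomputable section

open scoped Classical NumberField

namespace Summit.BirchSwinnertonDyer.BirchSwinnertonDyer.Theorems.KolyvaginDepthDoor

open Literature.NumberTheory.EllipticCurves Literature.NumberTheory.EllipticCurves.ModularForms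
  WeierstrassCurve NumberField IsDedekindDomain
open Summit.BirchSwinnertonDyer.BirchSwinnertonDyer.Theorems
open Summit.BirchSwinnertonDyer.BirchSwinnertonDyer.Rank2Observatory
open Summit.BirchSwinnertonDyer.BirchSwinnertonDyer.Rank1Residual
open Summit.BirchSwinnertonDyer.Rank1Residual.Additive

namespace C11197a1

/-- **THE CRUX `KolyvaginDepthSupplyKN` AT THE RANK-THREE CURVE `11197a1` FROM ONE EXACT `L`-VALUE.** Granted Stein–Wuthrich
2013 Thm. 1.1, W. Zhang 2014 Lemma 8.4 (1) / Thm. 9.1, Skinner 2016 Thm. C and Gross–Zagier–Kolyvagin BY NAME, the CLAUSE of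
the crux holds at `W = 11197a1` VERBATIM as soon as the Heegner twist `T = E^{(−7)}` (minimal model `[1,5,1,−270,−86]`, conductor
`548 653`) has `L(T, 1) ≠ 0` (numerically `≈ 5.30`) and `ord_5(L(T,1)/Ω_T) ≤ 0` — ONE modular-symbol computation on a
rank-ZERO curve. Chain: `natCard_selmerGroup_quadraticTwist_neg7_eq_one_of_LValue` (`#Sel_5(E^{(−7)}) = 1`) and
`cruxBody_of_twistSelmer`. CONDITIONAL on the four named facts and the two `L`-value hypotheses; per curve; BSD is not proved
by it. [cite: SteinWuthrich2013, Thm. 1.1 (p. 1758)] [cite: WZhang2014, Lemma 8.4 (1) (p. 236), Thm. 9.1 (p. 240)]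
[cite: Skinner2016PacificMC, Thm. C (p. 173)] [cite: Darmon2004, Thm. 3.22] -/
theorem cruxBody_of_twistLValue
    (hSW : SteinWuthrich2013_sha_inf_torsionBy_eq_bot_of_two_le_rank)
    (h84 : Literature.NumberTheory.EllipticCurves.WZhang2014_lemma84_exists_minimal_kolyvaginClass_one_selmerCard)
    (hSk : Skinner2016_padicValRat_bsd_rank_zero) (hGZK : rank_eq_analyticRank_of_analyticRank_le_one)
    (K : Type) [Field K] [NumberField K] (hK : IsImaginaryQuadratic K) (hD : NumberField.discr K = -7)
    (hL : haveI := isElliptic_twist7;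
      ((⟨1, 5, 1, -270, -86⟩ : WeierstrassCurve ℤ).map (Int.castRingHom ℚ)).entireLFunction 1 ≠ 0)
    (hval : haveI := isElliptic_twist7; haveI := isGloballyMinimal_twist7;
      ∀ q : ℚ, ((⟨1, 5, 1, -270, -86⟩ : WeierstrassCurve ℤ).map (Int.castRingHom ℚ)).entireLFunction 1 /
          ((((⟨1, 5, 1, -270, -86⟩ : WeierstrassCurve ℤ).map (Int.castRingHom ℚ)).realPeriodRat : ℝ) : ℂ) = (q : ℂ) →
        padicValRat 5 q ≤ 0) :
    haveI := isElliptic_of_mem_atlasR3A00 mem_atlas;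
    haveI := isGloballyMinimal_of_mem_atlasR3A00 mem_atlas;
    ∃ (p : ℕ) (hp : Fact p.Prime), 5 ≤ p ∧ (c11197a1.e.baseChange ℚ).HasGoodReductionAtPrime p ∧
      ¬ (p : ℤ) ∣ (c11197a1.e.baseChange ℚ).frobeniusTrace p ∧
      (∀ n : ℕ, (c11197a1.e.baseChange ℚ).HasSurjectiveModNGaloisRep (p ^ n : ℕ)) ∧
      (∀ v : HeightOneSpectrum (𝓞 ℚ), (c11197a1.e.baseChange ℚ).HasMultiplicativeReductionAt v →
        ¬ p ∣ (c11197a1.e.baseChange ℚ).ordMinimalDiscriminant v) ∧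
      ∃ (K : Type) (_ : Field K) (_ : NumberField K), IsImaginaryQuadratic K ∧
        NumberField.discr K ≠ -3 ∧ NumberField.discr K ≠ -4 ∧
        ∃ (_ : NeZero ((c11197a1.e.baseChange ℚ).conductorNorm ℤ)),
          SatisfiesHeegnerHypothesis ((c11197a1.e.baseChange ℚ).conductorNorm ℤ) K ∧
        ∃ (Dt : ModularParametrizationData (c11197a1.e.baseChange ℚ) ((c11197a1.e.baseChange ℚ).conductorNorm ℤ))
          (β : ℤ) (ι : K →+* ℂ) (n₁ : ℕ) (d : KolyvaginHeegnerData Dt β ι n₁), Squarefree n₁ ∧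
          (∀ q ∈ n₁.primeFactors,
            Zhang2014.IsKolyvaginPrime ((c11197a1.e.baseChange ℚ).conductorNorm ℤ) (c11197a1.e.baseChange ℚ) K p q) ∧
          d.kolyvaginClass hp.out 1 ≠ 0 ∧
          (n₁.primeFactors.card + 1 ≤ (c11197a1.e.baseChange ℚ).mordellWeilRank ∨
            (n₁.primeFactors.card ≤ (c11197a1.e.baseChange ℚ).mordellWeilRank ∧
              n₁.primeFactors.card + 1 ≤
                ((c11197a1.e.baseChange ℚ).quadraticTwist (NumberField.discr K : ℚ)).mordellWeilRank)) := by
  haveI := isElliptic_of_mem_atlasR3A00 mem_atlas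
  haveI := isGloballyMinimal_of_mem_atlasR3A00 mem_atlas
  have h1 := natCard_selmerGroup_quadraticTwist_neg7_eq_one_of_LValue hSk hGZK hL hval
  refine cruxBody_of_twistSelmer hSW h84 K hK hD ?_
  have hcast : (NumberField.discr K : ℚ) = (-7 : ℚ) := by rw [hD]; norm_num
  rw [hcast, h1]
  norm_num

end C11197a1

namespace C16811a1

/-- **THE CRUX `KolyvaginDepthSupplyKN` AT THE RANK-THREE CURVE `16811a1` FROM ONE EXACT `L`-VALUE.** Granted Stein–Wuthrich
2013 Thm. 1.1, W. Zhang 2014 Lemma 8.4 (1) / Thm. 9.1, Skinner 2016 Thm. C and Gross–Zagier–Kolyvagin BY NAME, the CLAUSE of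
the crux holds at `W = 16811a1` VERBATIM as soon as the Heegner twist `T = E^{(−7)}` (minimal model `[0,0,1,−49,−2144]`, conductor
`823 739`) has `L(T, 1) ≠ 0` (numerically `≈ 5.25`) and `ord_5(L(T,1)/Ω_T) ≤ 0` — ONE modular-symbol computation on a
rank-ZERO curve. Chain: `natCard_selmerGroup_quadraticTwist_neg7_eq_one_of_LValue` (`#Sel_5(E^{(−7)}) = 1`) and
`cruxBody_of_twistSelmer`. CONDITIONAL on the four named facts and the two `L`-value hypotheses; per curve; BSD is not proved
by it. [cite: SteinWuthrich2013, Thm. 1.1 (p. 1758)] [cite: WZhang2014, Lemma 8.4 (1) (p. 236), Thm. 9.1 (p. 240)]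
[cite: Skinner2016PacificMC, Thm. C (p. 173)] [cite: Darmon2004, Thm. 3.22] -/
theorem cruxBody_of_twistLValue
    (hSW : SteinWuthrich2013_sha_inf_torsionBy_eq_bot_of_two_le_rank)
    (h84 : Literature.NumberTheory.EllipticCurves.WZhang2014_lemma84_exists_minimal_kolyvaginClass_one_selmerCard)
    (hSk : Skinner2016_padicValRat_bsd_rank_zero) (hGZK : rank_eq_analyticRank_of_analyticRank_le_one)
    (K : Type) [Field K] [NumberField K] (hK : IsImaginaryQuadratic K) (hD : NumberField.discr K = -7)
    (hL : haveI := isElliptic_twist7;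
      ((⟨0, 0, 1, -49, -2144⟩ : WeierstrassCurve ℤ).map (Int.castRingHom ℚ)).entireLFunction 1 ≠ 0)
    (hval : haveI := isElliptic_twist7; haveI := isGloballyMinimal_twist7;
      ∀ q : ℚ, ((⟨0, 0, 1, -49, -2144⟩ : WeierstrassCurve ℤ).map (Int.castRingHom ℚ)).entireLFunction 1 /
          ((((⟨0, 0, 1, -49, -2144⟩ : WeierstrassCurve ℤ).map (Int.castRingHom ℚ)).realPeriodRat : ℝ) : ℂ) = (q : ℂ) →
        padicValRat 5 q ≤ 0) :
    haveI := isElliptic_of_mem_atlasR3A00 mem_atlas;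
    haveI := isGloballyMinimal_of_mem_atlasR3A00 mem_atlas;
    ∃ (p : ℕ) (hp : Fact p.Prime), 5 ≤ p ∧ (c16811a1.e.baseChange ℚ).HasGoodReductionAtPrime p ∧
      ¬ (p : ℤ) ∣ (c16811a1.e.baseChange ℚ).frobeniusTrace p ∧
      (∀ n : ℕ, (c16811a1.e.baseChange ℚ).HasSurjectiveModNGaloisRep (p ^ n : ℕ)) ∧
      (∀ v : HeightOneSpectrum (𝓞 ℚ), (c16811a1.e.baseChange ℚ).HasMultiplicativeReductionAt v →
        ¬ p ∣ (c16811a1.e.baseChange ℚ).ordMinimalDiscriminant v) ∧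
      ∃ (K : Type) (_ : Field K) (_ : NumberField K), IsImaginaryQuadratic K ∧
        NumberField.discr K ≠ -3 ∧ NumberField.discr K ≠ -4 ∧
        ∃ (_ : NeZero ((c16811a1.e.baseChange ℚ).conductorNorm ℤ)),
          SatisfiesHeegnerHypothesis ((c16811a1.e.baseChange ℚ).conductorNorm ℤ) K ∧
        ∃ (Dt : ModularParametrizationData (c16811a1.e.baseChange ℚ) ((c16811a1.e.baseChange ℚ).conductorNorm ℤ))
          (β : ℤ) (ι : K →+* ℂ) (n₁ : ℕ) (d : KolyvaginHeegnerData Dt β ι n₁), Squarefree n₁ ∧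
          (∀ q ∈ n₁.primeFactors,
            Zhang2014.IsKolyvaginPrime ((c16811a1.e.baseChange ℚ).conductorNorm ℤ) (c16811a1.e.baseChange ℚ) K p q) ∧
          d.kolyvaginClass hp.out 1 ≠ 0 ∧
          (n₁.primeFactors.card + 1 ≤ (c16811a1.e.baseChange ℚ).mordellWeilRank ∨
            (n₁.primeFactors.card ≤ (c16811a1.e.baseChange ℚ).mordellWeilRank ∧
              n₁.primeFactors.card + 1 ≤
                ((c16811a1.e.baseChange ℚ).quadraticTwist (NumberField.discr K : ℚ)).mordellWeilRank)) := by
  haveI := isElliptic_of_mem_atlasR3A00 mem_atlas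
  haveI := isGloballyMinimal_of_mem_atlasR3A00 mem_atlas
  have h1 := natCard_selmerGroup_quadraticTwist_neg7_eq_one_of_LValue hSk hGZK hL hval
  refine cruxBody_of_twistSelmer hSW h84 K hK hD ?_
  have hcast : (NumberField.discr K : ℚ) = (-7 : ℚ) := by rw [hD]; norm_num
  rw [hcast, h1]
  norm_num

end C16811a1

namespace C18097b1

/-- **THE CRUX `KolyvaginDepthSupplyKN` AT THE RANK-THREE CURVE `18097b1` FROM ONE EXACT `L`-VALUE.** Granted Stein–Wuthrich
2013 Thm. 1.1, W. Zhang 2014 Lemma 8.4 (1) / Thm. 9.1, Skinner 2016 Thm. C and Gross–Zagier–Kolyvagin BY NAME, the CLAUSE of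
the crux holds at `W = 18097b1` VERBATIM as soon as the Heegner twist `T = E^{(−7)}` (minimal model `[1,−9,1,−466,−2144]`, conductor
`886 753`) has `L(T, 1) ≠ 0` (numerically `≈ 4.10`) and `ord_5(L(T,1)/Ω_T) ≤ 0` — ONE modular-symbol computation on a
rank-ZERO curve. Chain: `natCard_selmerGroup_quadraticTwist_neg7_eq_one_of_LValue` (`#Sel_5(E^{(−7)}) = 1`) and
`cruxBody_of_twistSelmer`. CONDITIONAL on the four named facts and the two `L`-value hypotheses; per curve; BSD is not proved
by it. [cite: SteinWuthrich2013, Thm. 1.1 (p. 1758)] [cite: WZhang2014, Lemma 8.4 (1) (p. 236), Thm. 9.1 (p. 240)]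
[cite: Skinner2016PacificMC, Thm. C (p. 173)] [cite: Darmon2004, Thm. 3.22] -/
theorem cruxBody_of_twistLValue
    (hSW : SteinWuthrich2013_sha_inf_torsionBy_eq_bot_of_two_le_rank)
    (h84 : Literature.NumberTheory.EllipticCurves.WZhang2014_lemma84_exists_minimal_kolyvaginClass_one_selmerCard)
    (hSk : Skinner2016_padicValRat_bsd_rank_zero) (hGZK : rank_eq_analyticRank_of_analyticRank_le_one)
    (K : Type) [Field K] [NumberField K] (hK : IsImaginaryQuadratic K) (hD : NumberField.discr K = -7)
    (hL : haveI := isElliptic_twist7;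
      ((⟨1, -9, 1, -466, -2144⟩ : WeierstrassCurve ℤ).map (Int.castRingHom ℚ)).entireLFunction 1 ≠ 0)
    (hval : haveI := isElliptic_twist7; haveI := isGloballyMinimal_twist7;
      ∀ q : ℚ, ((⟨1, -9, 1, -466, -2144⟩ : WeierstrassCurve ℤ).map (Int.castRingHom ℚ)).entireLFunction 1 /
          ((((⟨1, -9, 1, -466, -2144⟩ : WeierstrassCurve ℤ).map (Int.castRingHom ℚ)).realPeriodRat : ℝ) : ℂ) = (q : ℂ) →
        padicValRat 5 q ≤ 0) :
    haveI := isElliptic_of_mem_atlasR3A00 mem_atlas;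
    haveI := isGloballyMinimal_of_mem_atlasR3A00 mem_atlas;
    ∃ (p : ℕ) (hp : Fact p.Prime), 5 ≤ p ∧ (c18097b1.e.baseChange ℚ).HasGoodReductionAtPrime p ∧
      ¬ (p : ℤ) ∣ (c18097b1.e.baseChange ℚ).frobeniusTrace p ∧
      (∀ n : ℕ, (c18097b1.e.baseChange ℚ).HasSurjectiveModNGaloisRep (p ^ n : ℕ)) ∧
      (∀ v : HeightOneSpectrum (𝓞 ℚ), (c18097b1.e.baseChange ℚ).HasMultiplicativeReductionAt v →
        ¬ p ∣ (c18097b1.e.baseChange ℚ).ordMinimalDiscriminant v) ∧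
      ∃ (K : Type) (_ : Field K) (_ : NumberField K), IsImaginaryQuadratic K ∧
        NumberField.discr K ≠ -3 ∧ NumberField.discr K ≠ -4 ∧
        ∃ (_ : NeZero ((c18097b1.e.baseChange ℚ).conductorNorm ℤ)),
          SatisfiesHeegnerHypothesis ((c18097b1.e.baseChange ℚ).conductorNorm ℤ) K ∧
        ∃ (Dt : ModularParametrizationData (c18097b1.e.baseChange ℚ) ((c18097b1.e.baseChange ℚ).conductorNorm ℤ))
          (β : ℤ) (ι : K →+* ℂ) (n₁ : ℕ) (d : KolyvaginHeegnerData Dt β ι n₁), Squarefree n₁ ∧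
          (∀ q ∈ n₁.primeFactors,
            Zhang2014.IsKolyvaginPrime ((c18097b1.e.baseChange ℚ).conductorNorm ℤ) (c18097b1.e.baseChange ℚ) K p q) ∧
          d.kolyvaginClass hp.out 1 ≠ 0 ∧
          (n₁.primeFactors.card + 1 ≤ (c18097b1.e.baseChange ℚ).mordellWeilRank ∨
            (n₁.primeFactors.card ≤ (c18097b1.e.baseChange ℚ).mordellWeilRank ∧
              n₁.primeFactors.card + 1 ≤
                ((c18097b1.e.baseChange ℚ).quadraticTwist (NumberField.discr K : ℚ)).mordellWeilRank)) := by
  haveI := isElliptic_of_mem_atlasR3A00 mem_atlas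
  haveI := isGloballyMinimal_of_mem_atlasR3A00 mem_atlas
  have h1 := natCard_selmerGroup_quadraticTwist_neg7_eq_one_of_LValue hSk hGZK hL hval
  refine cruxBody_of_twistSelmer hSW h84 K hK hD ?_
  have hcast : (NumberField.discr K : ℚ) = (-7 : ℚ) := by rw [hD]; norm_num
  rw [hcast, h1]
  norm_num

end C18097b1

namespace C11642a1

/-- **THE CRUX `KolyvaginDepthSupplyKN` AT THE RANK-THREE CURVE `11642a1` FROM ONE EXACT `L`-VALUE.** Granted Stein–Wuthrich
2013 Thm. 1.1, W. Zhang 2014 Lemma 8.4 (1) / Thm. 9.1, Skinner 2016 Thm. C and Gross–Zagier–Kolyvagin BY NAME, the CLAUSE of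
the crux holds at `W = 11642a1` VERBATIM as soon as the Heegner twist `T = E^{(−7)}` (minimal model `[1,5,0,−784,−9604]`, conductor
`570 458`) has `L(T, 1) ≠ 0` (numerically `≈ 7.22`) and `ord_5(L(T,1)/Ω_T) ≤ 0` — ONE modular-symbol computation on a
rank-ZERO curve. Chain: `natCard_selmerGroup_quadraticTwist_neg7_eq_one_of_LValue` (`#Sel_5(E^{(−7)}) = 1`) and
`cruxBody_of_twistSelmer`. CONDITIONAL on the four named facts and the two `L`-value hypotheses; per curve; BSD is not proved
by it. [cite: SteinWuthrich2013, Thm. 1.1 (p. 1758)] [cite: WZhang2014, Lemma 8.4 (1) (p. 236), Thm. 9.1 (p. 240)]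
[cite: Skinner2016PacificMC, Thm. C (p. 173)] [cite: Darmon2004, Thm. 3.22] -/
theorem cruxBody_of_twistLValue
    (hSW : SteinWuthrich2013_sha_inf_torsionBy_eq_bot_of_two_le_rank)
    (h84 : Literature.NumberTheory.EllipticCurves.WZhang2014_lemma84_exists_minimal_kolyvaginClass_one_selmerCard)
    (hSk : Skinner2016_padicValRat_bsd_rank_zero) (hGZK : rank_eq_analyticRank_of_analyticRank_le_one)
    (K : Type) [Field K] [NumberField K] (hK : IsImaginaryQuadratic K) (hD : NumberField.discr K = -7)
    (hL : haveI := isElliptic_twist7;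
      ((⟨1, 5, 0, -784, -9604⟩ : WeierstrassCurve ℤ).map (Int.castRingHom ℚ)).entireLFunction 1 ≠ 0)
    (hval : haveI := isElliptic_twist7; haveI := isGloballyMinimal_twist7;
      ∀ q : ℚ, ((⟨1, 5, 0, -784, -9604⟩ : WeierstrassCurve ℤ).map (Int.castRingHom ℚ)).entireLFunction 1 /
          ((((⟨1, 5, 0, -784, -9604⟩ : WeierstrassCurve ℤ).map (Int.castRingHom ℚ)).realPeriodRat : ℝ) : ℂ) = (q : ℂ) →
        padicValRat 5 q ≤ 0) :
    haveI := isElliptic_of_mem_atlasR3A00 mem_atlas;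
    haveI := isGloballyMinimal_of_mem_atlasR3A00 mem_atlas;
    ∃ (p : ℕ) (hp : Fact p.Prime), 5 ≤ p ∧ (c11642a1.e.baseChange ℚ).HasGoodReductionAtPrime p ∧
      ¬ (p : ℤ) ∣ (c11642a1.e.baseChange ℚ).frobeniusTrace p ∧
      (∀ n : ℕ, (c11642a1.e.baseChange ℚ).HasSurjectiveModNGaloisRep (p ^ n : ℕ)) ∧
      (∀ v : HeightOneSpectrum (𝓞 ℚ), (c11642a1.e.baseChange ℚ).HasMultiplicativeReductionAt v →
        ¬ p ∣ (c11642a1.e.baseChange ℚ).ordMinimalDiscriminant v) ∧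
      ∃ (K : Type) (_ : Field K) (_ : NumberField K), IsImaginaryQuadratic K ∧
        NumberField.discr K ≠ -3 ∧ NumberField.discr K ≠ -4 ∧
        ∃ (_ : NeZero ((c11642a1.e.baseChange ℚ).conductorNorm ℤ)),
          SatisfiesHeegnerHypothesis ((c11642a1.e.baseChange ℚ).conductorNorm ℤ) K ∧
        ∃ (Dt : ModularParametrizationData (c11642a1.e.baseChange ℚ) ((c11642a1.e.baseChange ℚ).conductorNorm ℤ))
          (β : ℤ) (ι : K →+* ℂ) (n₁ : ℕ) (d : KolyvaginHeegnerData Dt β ι n₁), Squarefree n₁ ∧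
          (∀ q ∈ n₁.primeFactors,
            Zhang2014.IsKolyvaginPrime ((c11642a1.e.baseChange ℚ).conductorNorm ℤ) (c11642a1.e.baseChange ℚ) K p q) ∧
          d.kolyvaginClass hp.out 1 ≠ 0 ∧
          (n₁.primeFactors.card + 1 ≤ (c11642a1.e.baseChange ℚ).mordellWeilRank ∨
            (n₁.primeFactors.card ≤ (c11642a1.e.baseChange ℚ).mordellWeilRank ∧
              n₁.primeFactors.card + 1 ≤
                ((c11642a1.e.baseChange ℚ).quadraticTwist (NumberField.discr K : ℚ)).mordellWeilRank)) := by
  haveI := isElliptic_of_mem_atlasR3A00 mem_atlas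
  haveI := isGloballyMinimal_of_mem_atlasR3A00 mem_atlas
  have h1 := natCard_selmerGroup_quadraticTwist_neg7_eq_one_of_LValue hSk hGZK hL hval
  refine cruxBody_of_twistSelmer hSW h84 K hK hD ?_
  have hcast : (NumberField.discr K : ℚ) = (-7 : ℚ) := by rw [hD]; norm_num
  rw [hcast, h1]
  norm_num

end C11642a1

namespace C13766a1

/-- **THE CRUX `KolyvaginDepthSupplyKN` AT THE RANK-THREE CURVE `13766a1` FROM ONE EXACT `L`-VALUE.** Granted Stein–Wuthrich
2013 Thm. 1.1, W. Zhang 2014 Lemma 8.4 (1) / Thm. 9.1, Skinner 2016 Thm. C and Gross–Zagier–Kolyvagin BY NAME, the CLAUSE of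
the crux holds at `W = 13766a1` VERBATIM as soon as the Heegner twist `T = E^{(−7)}` (minimal model `[1,−2,1,−1103,−14492]`, conductor
`674 534`) has `L(T, 1) ≠ 0` (numerically `≈ 6.59`) and `ord_5(L(T,1)/Ω_T) ≤ 0` — ONE modular-symbol computation on a
rank-ZERO curve. Chain: `natCard_selmerGroup_quadraticTwist_neg7_eq_one_of_LValue` (`#Sel_5(E^{(−7)}) = 1`) and
`cruxBody_of_twistSelmer`. CONDITIONAL on the four named facts and the two `L`-value hypotheses; per curve; BSD is not proved
by it. [cite: SteinWuthrich2013, Thm. 1.1 (p. 1758)] [cite: WZhang2014, Lemma 8.4 (1) (p. 236), Thm. 9.1 (p. 240)]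
[cite: Skinner2016PacificMC, Thm. C (p. 173)] [cite: Darmon2004, Thm. 3.22] -/
theorem cruxBody_of_twistLValue
    (hSW : SteinWuthrich2013_sha_inf_torsionBy_eq_bot_of_two_le_rank)
    (h84 : Literature.NumberTheory.EllipticCurves.WZhang2014_lemma84_exists_minimal_kolyvaginClass_one_selmerCard)
    (hSk : Skinner2016_padicValRat_bsd_rank_zero) (hGZK : rank_eq_analyticRank_of_analyticRank_le_one)
    (K : Type) [Field K] [NumberField K] (hK : IsImaginaryQuadratic K) (hD : NumberField.discr K = -7)
    (hL : haveI := isElliptic_twist7;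
      ((⟨1, -2, 1, -1103, -14492⟩ : WeierstrassCurve ℤ).map (Int.castRingHom ℚ)).entireLFunction 1 ≠ 0)
    (hval : haveI := isElliptic_twist7; haveI := isGloballyMinimal_twist7;
      ∀ q : ℚ, ((⟨1, -2, 1, -1103, -14492⟩ : WeierstrassCurve ℤ).map (Int.castRingHom ℚ)).entireLFunction 1 /
          ((((⟨1, -2, 1, -1103, -14492⟩ : WeierstrassCurve ℤ).map (Int.castRingHom ℚ)).realPeriodRat : ℝ) : ℂ) = (q : ℂ) →
        padicValRat 5 q ≤ 0) :
    haveI := isElliptic_of_mem_atlasR3A00 mem_atlas;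
    haveI := isGloballyMinimal_of_mem_atlasR3A00 mem_atlas;
    ∃ (p : ℕ) (hp : Fact p.Prime), 5 ≤ p ∧ (c13766a1.e.baseChange ℚ).HasGoodReductionAtPrime p ∧
      ¬ (p : ℤ) ∣ (c13766a1.e.baseChange ℚ).frobeniusTrace p ∧
      (∀ n : ℕ, (c13766a1.e.baseChange ℚ).HasSurjectiveModNGaloisRep (p ^ n : ℕ)) ∧
      (∀ v : HeightOneSpectrum (𝓞 ℚ), (c13766a1.e.baseChange ℚ).HasMultiplicativeReductionAt v →
        ¬ p ∣ (c13766a1.e.baseChange ℚ).ordMinimalDiscriminant v) ∧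
      ∃ (K : Type) (_ : Field K) (_ : NumberField K), IsImaginaryQuadratic K ∧
        NumberField.discr K ≠ -3 ∧ NumberField.discr K ≠ -4 ∧
        ∃ (_ : NeZero ((c13766a1.e.baseChange ℚ).conductorNorm ℤ)),
          SatisfiesHeegnerHypothesis ((c13766a1.e.baseChange ℚ).conductorNorm ℤ) K ∧
        ∃ (Dt : ModularParametrizationData (c13766a1.e.baseChange ℚ) ((c13766a1.e.baseChange ℚ).conductorNorm ℤ))
          (β : ℤ) (ι : K →+* ℂ) (n₁ : ℕ) (d : KolyvaginHeegnerData Dt β ι n₁), Squarefree n₁ ∧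
          (∀ q ∈ n₁.primeFactors,
            Zhang2014.IsKolyvaginPrime ((c13766a1.e.baseChange ℚ).conductorNorm ℤ) (c13766a1.e.baseChange ℚ) K p q) ∧
          d.kolyvaginClass hp.out 1 ≠ 0 ∧
          (n₁.primeFactors.card + 1 ≤ (c13766a1.e.baseChange ℚ).mordellWeilRank ∨
            (n₁.primeFactors.card ≤ (c13766a1.e.baseChange ℚ).mordellWeilRank ∧
              n₁.primeFactors.card + 1 ≤
                ((c13766a1.e.baseChange ℚ).quadraticTwist (NumberField.discr K : ℚ)).mordellWeilRank)) := by
  haveI := isElliptic_of_mem_atlasR3A00 mem_atlas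
  haveI := isGloballyMinimal_of_mem_atlasR3A00 mem_atlas
  have h1 := natCard_selmerGroup_quadraticTwist_neg7_eq_one_of_LValue hSk hGZK hL hval
  refine cruxBody_of_twistSelmer hSW h84 K hK hD ?_
  have hcast : (NumberField.discr K : ℚ) = (-7 : ℚ) := by rw [hD]; norm_num
  rw [hcast, h1]
  norm_num

end C13766a1

namespace C12279a1

/-- **THE CRUX `KolyvaginDepthSupplyKN` AT THE RANK-THREE CURVE `12279a1` FROM ONE EXACT `L`-VALUE.** Granted Stein–Wuthrich
2013 Thm. 1.1, W. Zhang 2014 Lemma 8.4 (1) / Thm. 9.1, Skinner 2016 Thm. C and Gross–Zagier–Kolyvagin BY NAME, the CLAUSE of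
the crux holds at `W = 12279a1` VERBATIM as soon as the Heegner twist `T = E^{(−47)}` (minimal model `[0,47,1,−22090,−1271832]`, conductor
`27 124 311`) has `L(T, 1) ≠ 0` (numerically `≈ 3.18`) and `ord_5(L(T,1)/Ω_T) ≤ 0` — ONE modular-symbol computation on a
rank-ZERO curve. Chain: `natCard_selmerGroup_quadraticTwist_neg47_eq_one_of_LValue` (`#Sel_5(E^{(−47)}) = 1`) and
`cruxBody_of_twistSelmer`. CONDITIONAL on the four named facts and the two `L`-value hypotheses; per curve; BSD is not proved
by it. [cite: SteinWuthrich2013, Thm. 1.1 (p. 1758)] [cite: WZhang2014, Lemma 8.4 (1) (p. 236), Thm. 9.1 (p. 240)]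
[cite: Skinner2016PacificMC, Thm. C (p. 173)] [cite: Darmon2004, Thm. 3.22] -/
theorem cruxBody_of_twistLValue
    (hSW : SteinWuthrich2013_sha_inf_torsionBy_eq_bot_of_two_le_rank)
    (h84 : Literature.NumberTheory.EllipticCurves.WZhang2014_lemma84_exists_minimal_kolyvaginClass_one_selmerCard)
    (hSk : Skinner2016_padicValRat_bsd_rank_zero) (hGZK : rank_eq_analyticRank_of_analyticRank_le_one)
    (K : Type) [Field K] [NumberField K] (hK : IsImaginaryQuadratic K) (hD : NumberField.discr K = -47)
    (hL : haveI := isElliptic_twist47;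
      ((⟨0, 47, 1, -22090, -1271832⟩ : WeierstrassCurve ℤ).map (Int.castRingHom ℚ)).entireLFunction 1 ≠ 0)
    (hval : haveI := isElliptic_twist47; haveI := isGloballyMinimal_twist47;
      ∀ q : ℚ, ((⟨0, 47, 1, -22090, -1271832⟩ : WeierstrassCurve ℤ).map (Int.castRingHom ℚ)).entireLFunction 1 /
          ((((⟨0, 47, 1, -22090, -1271832⟩ : WeierstrassCurve ℤ).map (Int.castRingHom ℚ)).realPeriodRat : ℝ) : ℂ) = (q : ℂ) →
        padicValRat 5 q ≤ 0) :
    haveI := isElliptic_of_mem_atlasR3A00 mem_atlas;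
    haveI := isGloballyMinimal_of_mem_atlasR3A00 mem_atlas;
    ∃ (p : ℕ) (hp : Fact p.Prime), 5 ≤ p ∧ (c12279a1.e.baseChange ℚ).HasGoodReductionAtPrime p ∧
      ¬ (p : ℤ) ∣ (c12279a1.e.baseChange ℚ).frobeniusTrace p ∧
      (∀ n : ℕ, (c12279a1.e.baseChange ℚ).HasSurjectiveModNGaloisRep (p ^ n : ℕ)) ∧
      (∀ v : HeightOneSpectrum (𝓞 ℚ), (c12279a1.e.baseChange ℚ).HasMultiplicativeReductionAt v →
        ¬ p ∣ (c12279a1.e.baseChange ℚ).ordMinimalDiscriminant v) ∧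
      ∃ (K : Type) (_ : Field K) (_ : NumberField K), IsImaginaryQuadratic K ∧
        NumberField.discr K ≠ -3 ∧ NumberField.discr K ≠ -4 ∧
        ∃ (_ : NeZero ((c12279a1.e.baseChange ℚ).conductorNorm ℤ)),
          SatisfiesHeegnerHypothesis ((c12279a1.e.baseChange ℚ).conductorNorm ℤ) K ∧
        ∃ (Dt : ModularParametrizationData (c12279a1.e.baseChange ℚ) ((c12279a1.e.baseChange ℚ).conductorNorm ℤ))
          (β : ℤ) (ι : K →+* ℂ) (n₁ : ℕ) (d : KolyvaginHeegnerData Dt β ι n₁), Squarefree n₁ ∧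
          (∀ q ∈ n₁.primeFactors,
            Zhang2014.IsKolyvaginPrime ((c12279a1.e.baseChange ℚ).conductorNorm ℤ) (c12279a1.e.baseChange ℚ) K p q) ∧
          d.kolyvaginClass hp.out 1 ≠ 0 ∧
          (n₁.primeFactors.card + 1 ≤ (c12279a1.e.baseChange ℚ).mordellWeilRank ∨
            (n₁.primeFactors.card ≤ (c12279a1.e.baseChange ℚ).mordellWeilRank ∧
              n₁.primeFactors.card + 1 ≤
                ((c12279a1.e.baseChange ℚ).quadraticTwist (NumberField.discr K : ℚ)).mordellWeilRank)) := by
  haveI := isElliptic_of_mem_atlasR3A00 mem_atlas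
  haveI := isGloballyMinimal_of_mem_atlasR3A00 mem_atlas
  have h1 := natCard_selmerGroup_quadraticTwist_neg47_eq_one_of_LValue hSk hGZK hL hval
  refine cruxBody_of_twistSelmer hSW h84 K hK hD ?_
  have hcast : (NumberField.discr K : ℚ) = (-47 : ℚ) := by rw [hD]; norm_num
  rw [hcast, h1]
  norm_num

end C12279a1

end Summit.BirchSwinnertonDyer.BirchSwinnertonDyer.Theorems.KolyvaginDepthDoor

end
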